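import Mathlib
import Summits.NavierStokesRegularity.NavierStokesRegularity.Theorems.FilamentSkeletonRssSkeletonJ1RLiaSliced

/-!
# Route `FilamentSkeletonRss` · crux `SkeletonJ1R` (stmt-NavierStokesRegularity-23610) · registered line `streamline_kantorovich_R`
# — brick F(i)-f for stub F1 `LiaFrameExistsL`: the two RATE HYPOTHESES of `…LiaSliced` hold for `Rb ≤ Rb₁(datum)` and `Γ ≥ Γ₁(datum, Rb)`

Lead `ns-fsr-lead-23610` (g0), `--supports stmt-NavierStokesRegularity-23610 --as helper`.  Pure real-variable bookkeeping: with `s = √Γ`, `L = log Γ`,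
`G_j = Σ_{k≠j}|γ_k|`, `g = |γ_j|`, `a = ½ + |α|`, `Q = ‖q_j‖`, the in-ball curvature ceiling of `…LiaSliced` is EXACTLY
`curvCeil = 8G_j/(gρ s L) + 8π√3 a Rb/(g s √L)` (`curvCeil_eq`), so
`curvCeil · (2(√3 Rb s √L + sQ) + 1) ≤ 48π a Rb²/g + C₁/√L` and `curvCeil · s ≤ C₂/√L` for `Γ ≥ 3`, `Rb ≤ 1` (`curvCeil_rate_bounds`), whence
`curvCeil_rates`: for every filament `j` there is `Rb₁ > 0` and, for `0 < Rb ≤ Rb₁`, a `Γ₁` beyond which both rate hypotheses of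
`IsLiaReference.slicedReference` hold (tilt budget `Rb/8` met with the Γ-free turning `48π(½+|α|)Rb²/|γ_j| ≤ Rb/16` and `o(1)` remainders), and
`curvCeil_rates_all`: the same simultaneously for all `j` (finite datum).

HONEST FRAMING.  Bookkeeping for the ∃-side of a HYPOTHETICAL filament-type rotating-self-similar blow-up skeleton (MODEL rung, negative side);
nothing here is a claim about Navier–Stokes regularity or blow-up; stub F1 and the crux stay OPEN.
-/

set_option linter.dupNamespace false -- `NavierStokesRegularity.NavierStokesRegularity` path/namespace repetition is the tree convention

noncomputable section

namespace Summit.NavierStokesRegularity.NavierStokesRegularity.Theorems.SkeletonJ1RFrame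

open Set Function Filter Real Topology
open scoped InnerProductSpace BigOperators

variable {N : ℕ}

/-- **Closed form of the curvature ceiling** for `Γ > 1`, `Rb ≥ 0`, `ρ > 0`, `γ_j ≠ 0`:
`curvCeil = 8G_j/(|γ_j| ρ √Γ log Γ) + 8π√3(½+|α|)Rb/(|γ_j| √Γ √(log Γ))`, `G_j = Σ_{k ≠ j}|γ_k|`. [folklore] -/
theorem curvCeil_eq (Γ Rb ρ : ℝ) (γ : Fin N → ℝ) (α : ℝ) (j : Fin N) (hΓ : 1 < Γ) (hRb : 0 ≤ Rb) (hρ : 0 < ρ) (hγ : γ j ≠ 0) :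
    curvCeil Γ Rb ρ γ α j =
      8 * (∑ k ∈ Finset.univ.erase j, |γ k|) / (|γ j| * ρ * Real.sqrt Γ * Real.log Γ) +
        8 * Real.pi * Real.sqrt 3 * (1/2 + |α|) * Rb / (|γ j| * Real.sqrt Γ * Real.sqrt (Real.log Γ)) := by
  have hΓ0 : 0 < Γ := by linarith
  have hL : 0 < Real.log Γ := Real.log_pos hΓ
  have hs : 0 < Real.sqrt Γ := Real.sqrt_pos.2 hΓ0
  have hsL : 0 < Real.sqrt (Real.log Γ) := Real.sqrt_pos.2 hL
  have hg : 0 < |γ j| := abs_pos.2 hγ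
  have hpi : 0 < Real.pi := Real.pi_pos
  have hsqrtΓL : Real.sqrt (Γ * Real.log Γ) = Real.sqrt Γ * Real.sqrt (Real.log Γ) := Real.sqrt_mul hΓ0.le _
  have hsum : (∑ k ∈ Finset.univ.erase j, |Γ*γ k/(4*Real.pi)| * (2 / (ρ / 2 * Real.sqrt Γ))) =
      (∑ k ∈ Finset.univ.erase j, |γ k|) * (Γ / (Real.pi * ρ * Real.sqrt Γ)) := by
    rw [Finset.sum_mul]
    refine Finset.sum_congr rfl fun k _ => ?_
    rw [abs_div, abs_mul, abs_of_pos hΓ0, abs_of_pos (by positivity : (0:ℝ) < 4 * Real.pi)]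
    field_simp
    ring
  unfold curvCeil liaCoeff
  rw [hsum, hsqrtΓL, abs_inv, abs_div, abs_mul, abs_mul, abs_of_pos hΓ0, abs_of_pos hL, abs_of_pos (by positivity : (0:ℝ) < 8 * Real.pi),
    abs_mul, abs_of_nonneg hRb, abs_of_pos (mul_pos hs hsL)]
  set r := Real.sqrt (Real.log Γ) with hr
  have hLL : Real.log Γ = r * r := (Real.mul_self_sqrt hL.le).symm
  have hr0 : 0 < r := hsL
  set q := Real.sqrt Γ with hq
  have hqq : Γ = q * q := (Real.mul_self_sqrt hΓ0.le).symm
  rw [hLL, hqq]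
  field_simp

/-- **Rate bounds** (`Γ ≥ 3`, `0 ≤ Rb ≤ 1`): with `Q = ‖q_j‖`, `G_j`, `a = ½+|α|`, `g = |γ_j|`,
`curvCeil·(2(√3|Rb√(Γ log Γ)| + ‖√Γ q_j‖) + 1) ≤ 48π a Rb²/g + C₁/√(log Γ)` and `curvCeil·√Γ ≤ C₂/√(log Γ)` with
`C₁ = (16√3 G + 8G(2Q+1))/(gρ) + 8π√3 a(2Q+1)/g`, `C₂ = 8G/(gρ) + 8π√3 a/g`. [folklore] -/
theorem curvCeil_rate_bounds (Γ Rb ρ : ℝ) (p t : Fin N → EuclideanSpace ℝ (Fin 3)) (s₀ : Fin N → ℝ) (γ : Fin N → ℝ) (α : ℝ)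
    (j : Fin N) (hΓ : 3 ≤ Γ) (hRb : 0 ≤ Rb) (hRb1 : Rb ≤ 1) (hρ : 0 < ρ) (hγ : γ j ≠ 0) :
    curvCeil Γ Rb ρ γ α j * (2 * (Real.sqrt 3 * |Rb * Real.sqrt (Γ * Real.log Γ)| + ‖waistPt Γ p t s₀ j‖) + 1) ≤
        48 * Real.pi * (1/2 + |α|) * Rb ^ 2 / |γ j| +
          ((16 * Real.sqrt 3 * (∑ k ∈ Finset.univ.erase j, |γ k|) + 8 * (∑ k ∈ Finset.univ.erase j, |γ k|) *
              (2 * ‖p j + s₀ j • t j‖ + 1)) / (|γ j| * ρ) +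
            8 * Real.pi * Real.sqrt 3 * (1/2 + |α|) * (2 * ‖p j + s₀ j • t j‖ + 1) / |γ j|) / Real.sqrt (Real.log Γ) ∧
      curvCeil Γ Rb ρ γ α j * Real.sqrt Γ ≤
        (8 * (∑ k ∈ Finset.univ.erase j, |γ k|) / (|γ j| * ρ) + 8 * Real.pi * Real.sqrt 3 * (1/2 + |α|) / |γ j|) /
          Real.sqrt (Real.log Γ) := by
  set G := ∑ k ∈ Finset.univ.erase j, |γ k| with hGdef
  set Q := ‖p j + s₀ j • t j‖ with hQdef
  set g := |γ j| with hgdef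
  set a := 1/2 + |α| with hadef
  have hΓ1 : 1 < Γ := by linarith
  have hΓ0 : 0 < Γ := by linarith
  have hlog3 : 1 < Real.log 3 := by
    rw [← Real.exp_lt_exp, Real.exp_log (by norm_num : (0:ℝ) < 3)]
    have := Real.exp_one_lt_d9; norm_num at this ⊢; linarith
  have hL1 : 1 ≤ Real.log Γ := hlog3.le.trans (Real.log_le_log (by norm_num) hΓ)
  have hL : 0 < Real.log Γ := by linarith
  set s := Real.sqrt Γ with hs_def
  set rL := Real.sqrt (Real.log Γ) with hrL
  have hs1 : 1 ≤ s := by rw [hs_def]; exact Real.one_le_sqrt.2 hΓ1.le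
  have hs : 0 < s := by linarith
  have hrL1 : 1 ≤ rL := by rw [hrL]; exact Real.one_le_sqrt.2 hL1
  have hrL0 : 0 < rL := by linarith
  have hrLL : rL * rL = Real.log Γ := Real.mul_self_sqrt hL.le
  have hg : 0 < g := abs_pos.2 hγ
  have ha : 0 < a := by rw [hadef]; positivity
  have hG : 0 ≤ G := Finset.sum_nonneg fun k _ => abs_nonneg _
  have hQ : 0 ≤ Q := norm_nonneg _
  have hpi : 0 < Real.pi := Real.pi_pos
  have h3 : 0 < Real.sqrt 3 := Real.sqrt_pos.2 (by norm_num)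
  have hceil := curvCeil_eq Γ Rb ρ γ α j hΓ1 hRb hρ hγ
  -- rewrite curvCeil in terms of s, rL
  have hceil' : curvCeil Γ Rb ρ γ α j = 8 * G / (g * ρ * s * (rL * rL)) + 8 * Real.pi * Real.sqrt 3 * a * Rb / (g * s * rL) := by
    rw [hceil, hrLL]
  -- sizes
  have hwaist : ‖waistPt Γ p t s₀ j‖ = s * Q := by
    rw [waistPt_eq, norm_smul, Real.norm_of_nonneg (Real.sqrt_nonneg Γ)]
  have hℓ : |Rb * Real.sqrt (Γ * Real.log Γ)| = Rb * s * rL := by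
    rw [Real.sqrt_mul hΓ0.le, abs_of_nonneg (by positivity)]; ring
  constructor
  · -- first rate
    have hm : 2 * (Real.sqrt 3 * |Rb * Real.sqrt (Γ * Real.log Γ)| + ‖waistPt Γ p t s₀ j‖) + 1 ≤
        s * (2 * Real.sqrt 3 * Rb * rL + 2 * Q + 1) := by
      rw [hℓ, hwaist]; nlinarith [hs1, h3.le, hRb, hrL0.le, hQ]
    have hc0 : 0 ≤ curvCeil Γ Rb ρ γ α j := curvCeil_nonneg hρ.le j
    calc curvCeil Γ Rb ρ γ α j * (2 * (Real.sqrt 3 * |Rb * Real.sqrt (Γ * Real.log Γ)| + ‖waistPt Γ p t s₀ j‖) + 1)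
        ≤ curvCeil Γ Rb ρ γ α j * (s * (2 * Real.sqrt 3 * Rb * rL + 2 * Q + 1)) := mul_le_mul_of_nonneg_left hm hc0
      _ = 16 * Real.pi * Real.sqrt 3 ^ 2 * a * Rb ^ 2 / g
            + (16 * Real.sqrt 3 * G * Rb / (g * ρ) + 8 * Real.pi * Real.sqrt 3 * a * Rb * (2 * Q + 1) / g) / rL
            + (8 * G * (2 * Q + 1) / (g * ρ)) / (rL * rL) := by
          rw [hceil']; field_simp; ring
      _ ≤ 48 * Real.pi * a * Rb ^ 2 / g +
            ((16 * Real.sqrt 3 * G + 8 * G * (2 * Q + 1)) / (g * ρ) + 8 * Real.pi * Real.sqrt 3 * a * (2 * Q + 1) / g) / rL := by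
          have h33 : Real.sqrt 3 ^ 2 = 3 := Real.sq_sqrt (by norm_num)
          rw [h33]
          -- Rb ≤ 1 in the middle terms and 1/(rL²) ≤ 1/rL
          have h1 : 16 * Real.sqrt 3 * G * Rb / (g * ρ) ≤ 16 * Real.sqrt 3 * G / (g * ρ) :=
            div_le_div_of_nonneg_right (mul_le_of_le_one_right (by positivity) hRb1) (by positivity)
          have h2 : 8 * Real.pi * Real.sqrt 3 * a * Rb * (2 * Q + 1) / g ≤ 8 * Real.pi * Real.sqrt 3 * a * (2 * Q + 1) / g := by
            apply div_le_div_of_nonneg_right _ hg.le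
            have h0 : 0 ≤ 8 * Real.pi * Real.sqrt 3 * a * (2 * Q + 1) := by positivity
            calc 8 * Real.pi * Real.sqrt 3 * a * Rb * (2 * Q + 1) = 8 * Real.pi * Real.sqrt 3 * a * (2 * Q + 1) * Rb := by ring
              _ ≤ 8 * Real.pi * Real.sqrt 3 * a * (2 * Q + 1) := mul_le_of_le_one_right h0 hRb1
          have h4 : (8 * G * (2 * Q + 1) / (g * ρ)) / (rL * rL) ≤ (8 * G * (2 * Q + 1) / (g * ρ)) / rL := by
            apply div_le_div_of_nonneg_left (by positivity) hrL0
            nlinarith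
          have h5 : (16 * Real.sqrt 3 * G * Rb / (g * ρ) + 8 * Real.pi * Real.sqrt 3 * a * Rb * (2 * Q + 1) / g) / rL ≤
              (16 * Real.sqrt 3 * G / (g * ρ) + 8 * Real.pi * Real.sqrt 3 * a * (2 * Q + 1) / g) / rL :=
            div_le_div_of_nonneg_right (add_le_add h1 h2) hrL0.le
          have hsplit : ((16 * Real.sqrt 3 * G + 8 * G * (2 * Q + 1)) / (g * ρ) + 8 * Real.pi * Real.sqrt 3 * a * (2 * Q + 1) / g) / rL
              = (16 * Real.sqrt 3 * G / (g * ρ) + 8 * Real.pi * Real.sqrt 3 * a * (2 * Q + 1) / g) / rL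
                + (8 * G * (2 * Q + 1) / (g * ρ)) / rL := by
            field_simp; ring
          have h6 : 16 * Real.pi * 3 * a * Rb ^ 2 / g = 48 * Real.pi * a * Rb ^ 2 / g := by ring
          rw [hsplit, h6]; linarith
  · -- second rate
    calc curvCeil Γ Rb ρ γ α j * s = 8 * G / (g * ρ) / (rL * rL) + 8 * Real.pi * Real.sqrt 3 * a * Rb / g / rL := by
          rw [hceil']; field_simp
      _ ≤ 8 * G / (g * ρ) / rL + 8 * Real.pi * Real.sqrt 3 * a / g / rL := by
          have h1 : 8 * G / (g * ρ) / (rL * rL) ≤ 8 * G / (g * ρ) / rL := by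
            apply div_le_div_of_nonneg_left (by positivity) hrL0; nlinarith
          have h2 : 8 * Real.pi * Real.sqrt 3 * a * Rb / g / rL ≤ 8 * Real.pi * Real.sqrt 3 * a / g / rL := by
            apply div_le_div_of_nonneg_right _ hrL0.le
            apply div_le_div_of_nonneg_right _ hg.le
            exact mul_le_of_le_one_right (by positivity) hRb1
          linarith
      _ = (8 * G / (g * ρ) + 8 * Real.pi * Real.sqrt 3 * a / g) / rL := by ring

set_option maxHeartbeats 400000 in
/-- **THE RATE HYPOTHESES HOLD EVENTUALLY (one filament).**  For `ρ > 0`, `γ_j ≠ 0` there is `Rb₁ ∈ (0, 1]` (`Rb₁ = min 1 (|γ_j|/(768π(½+|α|)))`)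
such that for every `0 < Rb ≤ Rb₁` there is `Γ₁ ≥ 3` with, for all `Γ ≥ Γ₁`: the two rate hypotheses of `IsLiaReference.slicedReference` for `j`,
and `Rb√(Γ log Γ) ≠ 0`. [folklore] -/
theorem curvCeil_rates (ρ : ℝ) (p t : Fin N → EuclideanSpace ℝ (Fin 3)) (s₀ : Fin N → ℝ) (γ : Fin N → ℝ) (α : ℝ) (j : Fin N)
    (hρ : 0 < ρ) (hγ : γ j ≠ 0) :
    ∃ Rb₁ : ℝ, 0 < Rb₁ ∧ ∀ Rb : ℝ, 0 < Rb → Rb ≤ Rb₁ → ∃ Γ₁ : ℝ, 3 ≤ Γ₁ ∧ ∀ Γ : ℝ, Γ₁ ≤ Γ →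
      curvCeil Γ Rb ρ γ α j * (2 * (Real.sqrt 3 * |Rb * Real.sqrt (Γ * Real.log Γ)| + ‖waistPt Γ p t s₀ j‖) + 1) ≤ Rb / 8 ∧
      curvCeil Γ Rb ρ γ α j * Real.sqrt Γ ≤ Rb / 2 ∧ Rb * Real.sqrt (Γ * Real.log Γ) ≠ 0 := by
  have hg : 0 < |γ j| := abs_pos.2 hγ
  have ha : (0:ℝ) < 1/2 + |α| := by positivity
  have hG : 0 ≤ ∑ k ∈ Finset.univ.erase j, |γ k| := Finset.sum_nonneg fun k _ => abs_nonneg _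
  have hQ : 0 ≤ ‖p j + s₀ j • t j‖ := norm_nonneg _
  have hpi : 0 < Real.pi := Real.pi_pos
  have h3 : 0 < Real.sqrt 3 := Real.sqrt_pos.2 (by norm_num)
  -- the rate bounds for all `Γ ≥ 3`, `0 ≤ Rb ≤ 1`, with the datum constants generalised to opaque names
  have key := fun (Rb Γ : ℝ) (hΓ : 3 ≤ Γ) (hRb : 0 ≤ Rb) (hRb1 : Rb ≤ 1) =>
    curvCeil_rate_bounds Γ Rb ρ p t s₀ γ α j hΓ hRb hRb1 hρ hγ
  have hC₁0 : 0 ≤ (16 * Real.sqrt 3 * (∑ k ∈ Finset.univ.erase j, |γ k|) + 8 * (∑ k ∈ Finset.univ.erase j, |γ k|) *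
      (2 * ‖p j + s₀ j • t j‖ + 1)) / (|γ j| * ρ) + 8 * Real.pi * Real.sqrt 3 * (1/2 + |α|) * (2 * ‖p j + s₀ j • t j‖ + 1) / |γ j| := by
    positivity
  have hC₂0 : 0 ≤ 8 * (∑ k ∈ Finset.univ.erase j, |γ k|) / (|γ j| * ρ) + 8 * Real.pi * Real.sqrt 3 * (1/2 + |α|) / |γ j| := by
    positivity
  generalize hC₁ : (16 * Real.sqrt 3 * (∑ k ∈ Finset.univ.erase j, |γ k|) + 8 * (∑ k ∈ Finset.univ.erase j, |γ k|) *
      (2 * ‖p j + s₀ j • t j‖ + 1)) / (|γ j| * ρ) + 8 * Real.pi * Real.sqrt 3 * (1/2 + |α|) * (2 * ‖p j + s₀ j • t j‖ + 1) / |γ j| = C₁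
    at key hC₁0
  generalize hC₂ : 8 * (∑ k ∈ Finset.univ.erase j, |γ k|) / (|γ j| * ρ) + 8 * Real.pi * Real.sqrt 3 * (1/2 + |α|) / |γ j| = C₂
    at key hC₂0
  generalize hg' : |γ j| = g at key hg
  generalize ha' : (1:ℝ)/2 + |α| = a at key ha
  refine ⟨min 1 (g / (768 * Real.pi * a)), lt_min one_pos (by positivity), fun Rb hRb hRb₁ => ?_⟩
  have hRb1 : Rb ≤ 1 := hRb₁.trans (min_le_left _ _)
  have hRbg : Rb ≤ g / (768 * Real.pi * a) := hRb₁.trans (min_le_right _ _)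
  have hden : 0 < 16 * C₁ + 2 * C₂ + 1 := by positivity
  obtain ⟨ε, hε⟩ : ∃ ε : ℝ, ε = Rb / (16 * C₁ + 2 * C₂ + 1) := ⟨_, rfl⟩
  have hε0 : 0 < ε := by rw [hε]; positivity
  refine ⟨max 3 (Real.exp (1 / ε ^ 2)), le_max_left _ _, fun Γ hΓ => ?_⟩
  have hΓ3 : 3 ≤ Γ := (le_max_left _ _).trans hΓ
  have hΓ0 : 0 < Γ := by linarith
  have hΓ1 : 1 < Γ := by linarith
  have hL : 0 < Real.log Γ := Real.log_pos hΓ1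
  have hlogε : 1 / ε ^ 2 ≤ Real.log Γ := by
    rw [Real.le_log_iff_exp_le hΓ0]; exact (le_max_right _ _).trans hΓ
  obtain ⟨rL, hrL⟩ : ∃ rL : ℝ, rL = Real.sqrt (Real.log Γ) := ⟨_, rfl⟩
  have hrL0 : 0 < rL := by rw [hrL]; exact Real.sqrt_pos.2 hL
  have hrLε : 1 / ε ≤ rL := by
    rw [hrL, show 1 / ε = Real.sqrt ((1 / ε) ^ 2) by rw [Real.sqrt_sq (by positivity)]]
    exact Real.sqrt_le_sqrt (by rw [div_pow, one_pow]; exact hlogε)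
  have h1ε : 1 ≤ ε * rL := by
    have := mul_le_mul_of_nonneg_left hrLε hε0.le
    rwa [mul_one_div_cancel hε0.ne'] at this
  have hinv : ∀ C : ℝ, 0 ≤ C → C / rL ≤ C * ε := by
    intro C hC
    rw [div_le_iff₀ hrL0]
    nlinarith
  obtain ⟨hr1, hr2⟩ := key Rb Γ hΓ3 hRb.le hRb1
  rw [← hrL] at hr1 hr2
  have hεC₁ : C₁ * ε ≤ Rb / 16 := by
    rw [hε, mul_div_assoc', div_le_div_iff₀ hden (by norm_num : (0:ℝ) < 16)]
    nlinarith [hC₁0, hC₂0, hRb]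
  have hεC₂ : C₂ * ε ≤ Rb / 2 := by
    rw [hε, mul_div_assoc', div_le_div_iff₀ hden (by norm_num : (0:ℝ) < 2)]
    nlinarith [hC₁0, hC₂0, hRb]
  refine ⟨?_, hr2.trans ((hinv C₂ hC₂0).trans hεC₂), mul_ne_zero hRb.ne' (Real.sqrt_pos.2 (mul_pos hΓ0 hL)).ne'⟩
  have hA : 48 * Real.pi * a * Rb ^ 2 / g ≤ Rb / 16 := by
    rw [div_le_iff₀ hg]
    have h1 : Rb * (768 * Real.pi * a) ≤ g := (le_div_iff₀ (by positivity)).1 hRbg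
    nlinarith [hRb]
  have hB : C₁ / rL ≤ Rb / 16 := (hinv C₁ hC₁0).trans hεC₁
  linarith

/-- **THE RATE HYPOTHESES HOLD EVENTUALLY (all filaments at once).**  For a finite datum (`0 < N`, `ρ > 0`, all `γ_j ≠ 0`) there is `Rb₁ > 0` and,
for every `0 < Rb ≤ Rb₁`, a `Γ₁ ≥ 3` beyond which both rate hypotheses hold for every `j` (and `Rb√(Γ log Γ) ≠ 0`). [folklore] -/
theorem curvCeil_rates_all (hN : 0 < N) (ρ : ℝ) (p t : Fin N → EuclideanSpace ℝ (Fin 3)) (s₀ : Fin N → ℝ) (γ : Fin N → ℝ) (α : ℝ)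
    (hρ : 0 < ρ) (hγ : ∀ j, γ j ≠ 0) :
    ∃ Rb₁ : ℝ, 0 < Rb₁ ∧ ∀ Rb : ℝ, 0 < Rb → Rb ≤ Rb₁ → ∃ Γ₁ : ℝ, 3 ≤ Γ₁ ∧ ∀ Γ : ℝ, Γ₁ ≤ Γ →
      (∀ j, curvCeil Γ Rb ρ γ α j * (2 * (Real.sqrt 3 * |Rb * Real.sqrt (Γ * Real.log Γ)| + ‖waistPt Γ p t s₀ j‖) + 1) ≤ Rb / 8) ∧
      (∀ j, curvCeil Γ Rb ρ γ α j * Real.sqrt Γ ≤ Rb / 2) ∧ Rb * Real.sqrt (Γ * Real.log Γ) ≠ 0 := by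
  have hne : (Finset.univ : Finset (Fin N)).Nonempty := ⟨⟨0, hN⟩, Finset.mem_univ _⟩
  choose Rb₁ hRb₁0 hRb₁ using fun j => curvCeil_rates ρ p t s₀ γ α j hρ (hγ j)
  refine ⟨Finset.univ.inf' hne Rb₁, (Finset.lt_inf'_iff hne).2 fun j _ => hRb₁0 j, fun Rb hRb hle => ?_⟩
  have hle' : ∀ j, Rb ≤ Rb₁ j := fun j => hle.trans (Finset.inf'_le _ (Finset.mem_univ j))
  choose Γ₁ hΓ₁3 hΓ₁ using fun j => hRb₁ j Rb hRb (hle' j)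
  refine ⟨Finset.univ.sup' hne Γ₁, (hΓ₁3 ⟨0, hN⟩).trans (Finset.le_sup' Γ₁ (Finset.mem_univ _)), fun Γ hΓ => ?_⟩
  have hΓ' : ∀ j, Γ₁ j ≤ Γ := fun j => (Finset.le_sup' Γ₁ (Finset.mem_univ j)).trans hΓ
  exact ⟨fun j => (hΓ₁ j Γ (hΓ' j)).1, fun j => (hΓ₁ j Γ (hΓ' j)).2.1, (hΓ₁ ⟨0, hN⟩ Γ (hΓ' _)).2.2⟩

end Summit.NavierStokesRegularity.NavierStokesRegularity.Theorems.SkeletonJ1RFrame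

end
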